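import Summits.BirchSwinnertonDyer.Rank1Residual.P2.CongruentNumberThetaFourPrimes
import HarnessLib
import HarnessLib.Audit.Tags

/-!
# Cell «bsd-monsky» (prover-B): a `k = 4` type through the uniform Θ-criterion — part 2: the Θ-certificate of
# `n = 2p₁p₂p₃p₄` (`p₁ ≡ 3`, `p₂ ≡ p₃ ≡ p₄ ≡ 5 (mod 8)`), THEOREM B₄(3555) «`g(n)` odd ⟹ `𝓛(n)` odd», and clause (a)
# `ord_{s=1} L(E_n, s) = 1` on the explicit family, relative to {`tyz_cmPointGaloisData`, TYZ Thm. 1.1} (kernel theorem; nothing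
# asserted, nothing booked)

HONEST FRAMING (cell `bsd-monsky`, run/shared/lean/pub/bsd-monsky/; README §1/§3): the cell's CLAIMED theorem is Monsky's 1990
conjecture on the `k = 2` family `𝒮⁻`; «ℓ ≥ 3 rungs are NOT claimed — record what the same argument gives there, no more». THIS FILE
completes the FIRST `k = 4` instance of the record (companion `…ThetaFourPrimes.lean`: `θ`-control with the composite good `5`-block
`p₂p₃p₄`, the `6`-blocks `2p₁z`, the `t = 4` Rédei bit `g(n) ≡ 1 + Σ_{pairs sharing a prime} sₐs_b`): the Θ-certificate is
`s(n) = g(n) + Σ_{6-blocks d₀ ∈ R(n)} 𝓛(n/d₀)·g(d₀)`, `s(e) = g(e)` otherwise; the `6`-blocks of `R(n)` are the `2p₁pᵢ` with cofactors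
`pⱼp_k`, and `𝓛(pⱼp_k)` is EVEN (`g(pⱼp_k)` even by the two-prime Rédei bit + TYZ Thm. 1.1), so `Θ(n) ≡ g(n)` and ONE application of
`ThetaDescent.odd_scriptL_of_thetaCert` gives THEOREM B₄(3555). Output at `k = 4`: `𝓛(n)` odd, `𝓛(n) ≠ 0`, `ord_{s=1} L(E_n, s) = 1`
(display + Thm. 1.1), an odd `L` with `L² = 𝓛(n)²` (+ GZK). NO `BSD(E, 2)` statement (the tree's even `2`-descent door is for three
odd primes) and NO kernel statement about TYZ's `Σ₂′` at `k = 4` (the configuration calculus of `Σ₂′` is typed for three primes); that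
`θ` decides SILENT `k = 4` cells of this type — e.g. `11310 = 2·3·5·13·29`, `41470`, `53070` (census types `[3,5,5,5]/…` of
HOME/proof/PROOF-B-K3-SCOPE.md §4, kit j246343) — is a CONTROL statement, not a theorem of this file. CONDITIONAL on the named facts
said; nothing asserted; no count moves; no class booked. NOT refereed; not part of PROOF-B v1.3 or of the paper.

References: [TianYuanZhang2017] Thm. 1.1, §1 (1.1), §3.1 (p0011 L67–L73), Prop. 3.2, Thm. 3.5, Thm. 3.6 (J741), proof of Lemma 3.21
(J759); [LiMa2008] Thm. 0.4; [IrelandRosen1990] Ch. 5 §2 Thm. 1; HOME/proof/PROOF-B-THETA-CRITERION.md.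
-/

noncomputable section

open scoped Classical

open Matrix Finset WeierstrassCurve Literature.NumberTheory.EllipticCurves
  Literature.NumberTheory.EllipticCurves.Rank1Residual
  Literature.NumberTheory.EllipticCurves.Rank1Residual.Typed
  Literature.NumberTheory.EllipticCurves.HeathBrown1994
  Literature.NumberTheory.EllipticCurves.Tian2014
  Literature.NumberTheory.EllipticCurves.TianYuanZhang2017
  Literature.NumberTheory.EllipticCurves.TianYuanZhang2017.W2
  Literature.NumberTheory.QuadraticFields.RedeiReichardt

set_option autoImplicit false

namespace Summit.BirchSwinnertonDyer.Rank1Residual.P2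

namespace ThetaDescent

variable {p₁ p₂ p₃ p₄ : ℕ}

/-! ## §1 The `6`-blocks with cofactor `≡ 1 (mod 8)` and the `6`-blocks of `R(n)` -/

/-- `n = 2p₁p₂p₃p₄` is square-free for the type `(3,5,5,5)`. [cite: HardyWright2008, §1.3 Thm. 2] -/
theorem squarefree_two_mul_3555 (hp₁ : p₁.Prime) (hp₂ : p₂.Prime) (hp₃ : p₃.Prime) (hp₄ : p₄.Prime) (h₁ : p₁ % 8 = 3)
    (h₂ : p₂ % 8 = 5) (h₃ : p₃ % 8 = 5) (h₄ : p₄ % 8 = 5) (h23 : p₂ ≠ p₃) (h24 : p₂ ≠ p₄) (h34 : p₃ ≠ p₄) :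
    Squarefree (2 * (p₁ * p₂ * p₃ * p₄)) := by
  obtain ⟨ht, -, hinj⟩ := quad_3555 hp₁ hp₂ hp₃ hp₄ h₁ h₂ h₃ h₄ h23 h24 h34
  have hodd : ∀ i, Odd ((![p₁, p₂, p₃, p₄] : Fin 4 → ℕ) i) := fun i => by
    fin_cases i <;> exact Nat.odd_iff.mpr (by simp; omega)
  have h := squarefree_two_mul_prod_of_injective _ ht hodd hinj
  rw [Fin.prod_univ_four] at h
  exact h

/-- `2p₁p₂p₃p₄ ≡ 6 (mod 8)` for the type `(3,5,5,5)`. [cite: TianYuanZhang2017, §3 (p0010 L3–L5)] -/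
theorem two_mul_3555_mod_eight (h₁ : p₁ % 8 = 3) (h₂ : p₂ % 8 = 5) (h₃ : p₃ % 8 = 5) (h₄ : p₄ % 8 = 5) :
    (2 * (p₁ * p₂ * p₃ * p₄)) % 8 = 6 := by
  have h12 : (p₁ * p₂) % 8 = 7 := by rw [Nat.mul_mod, h₁, h₂]
  have h123 : (p₁ * p₂ * p₃) % 8 = 3 := by rw [Nat.mul_mod, h12, h₃]
  have hm : (p₁ * p₂ * p₃ * p₄) % 8 = 7 := by rw [Nat.mul_mod, h123, h₄]
  omega

/-- **The `6`-blocks `e ∣ n` with cofactor `n/e ≡ 1 (mod 8)` are `n` and the three `2p₁pᵢ`** (cofactors `1` and `pⱼp_k`).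
[cite: TianYuanZhang2017, §3.1 (p0011 L67–L70)] -/
theorem six_block_cofactor_one_3555 (hp₁ : p₁.Prime) (hp₂ : p₂.Prime) (hp₃ : p₃.Prime) (hp₄ : p₄.Prime) (h₁ : p₁ % 8 = 3)
    (h₂ : p₂ % 8 = 5) (h₃ : p₃ % 8 = 5) (h₄ : p₄ % 8 = 5) {e : ℕ} (he : e ∣ 2 * (p₁ * p₂ * p₃ * p₄)) (he6 : e % 8 = 6)
    (hq1 : (2 * (p₁ * p₂ * p₃ * p₄) / e) % 8 = 1) :
    e = 2 * (p₁ * p₂ * p₃ * p₄) ∨ (e = 2 * (p₁ * p₂) ∧ 2 * (p₁ * p₂ * p₃ * p₄) / e = p₃ * p₄) ∨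
      (e = 2 * (p₁ * p₃) ∧ 2 * (p₁ * p₂ * p₃ * p₄) / e = p₂ * p₄) ∨
      (e = 2 * (p₁ * p₄) ∧ 2 * (p₁ * p₂ * p₃ * p₄) / e = p₂ * p₃) := by
  obtain ⟨z, hz, rfl⟩ := six_block_3555 hp₁ hp₂ hp₃ hp₄ h₁ h₂ h₃ h₄ he he6
  have hzpos : 0 < z := Nat.pos_of_dvd_of_pos hz (Nat.mul_pos (Nat.mul_pos hp₂.pos hp₃.pos) hp₄.pos)
  have hquot : 2 * (p₁ * p₂ * p₃ * p₄) / (2 * p₁ * z) = p₂ * p₃ * p₄ / z := by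
    apply Nat.div_eq_of_eq_mul_right (Nat.mul_pos (by omega) hzpos)
    rw [mul_assoc (2 * p₁) z (p₂ * p₃ * p₄ / z), Nat.mul_div_cancel' hz]; ring
  rw [hquot] at hq1 ⊢
  obtain ⟨-, hcases⟩ := dvd_P_3555 hp₂ hp₃ hp₄ h₂ h₃ h₄ hz
  have e₂ : p₂ * p₃ * p₄ / p₂ = p₃ * p₄ := by
    rw [show p₂ * p₃ * p₄ = p₂ * (p₃ * p₄) by ring]; exact Nat.mul_div_cancel_left _ hp₂.pos
  have e₃ : p₂ * p₃ * p₄ / p₃ = p₂ * p₄ := by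
    rw [show p₂ * p₃ * p₄ = p₃ * (p₂ * p₄) by ring]; exact Nat.mul_div_cancel_left _ hp₃.pos
  have e₄ : p₂ * p₃ * p₄ / p₄ = p₂ * p₃ := Nat.mul_div_cancel _ hp₄.pos
  rcases hcases hq1 with rfl | rfl | rfl | rfl
  · left; ring
  · right; left; exact ⟨by ring, e₂⟩
  · right; right; left; exact ⟨by ring, e₃⟩
  · right; right; right; exact ⟨by ring, e₄⟩

/-- **The `6`-blocks of `R(n)` are among the `2p₁pᵢ`, with cofactors `pⱼp_k`.** [cite: TianYuanZhang2017, §3.1 (p0011 L67–L70)] -/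
theorem mem_filter_six_recursionIndex_3555 (hp₁ : p₁.Prime) (hp₂ : p₂.Prime) (hp₃ : p₃.Prime) (hp₄ : p₄.Prime)
    (h₁ : p₁ % 8 = 3) (h₂ : p₂ % 8 = 5) (h₃ : p₃ % 8 = 5) (h₄ : p₄ % 8 = 5) {d₀ : ℕ}
    (hd₀ : d₀ ∈ (recursionIndex (2 * (p₁ * p₂ * p₃ * p₄))).filter (fun d₀ => d₀ % 8 = 6)) :
    (d₀ = 2 * (p₁ * p₂) ∧ 2 * (p₁ * p₂ * p₃ * p₄) / d₀ = p₃ * p₄) ∨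
      (d₀ = 2 * (p₁ * p₃) ∧ 2 * (p₁ * p₂ * p₃ * p₄) / d₀ = p₂ * p₄) ∨
      (d₀ = 2 * (p₁ * p₄) ∧ 2 * (p₁ * p₂ * p₃ * p₄) / d₀ = p₂ * p₃) := by
  obtain ⟨hR, h6⟩ := Finset.mem_filter.mp hd₀
  have hlt := lt_of_mem_recursionIndex hR
  obtain ⟨hd, -, -, -⟩ := mem_recursionIndex_iff.mp hR
  rcases sub_of_six (two_mul_3555_mod_eight h₁ h₂ h₃ h₄) hR with ⟨-, hq1⟩ | ⟨h7, -⟩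
  · rcases six_block_cofactor_one_3555 hp₁ hp₂ hp₃ hp₄ h₁ h₂ h₃ h₄ (Nat.mem_divisors.mp hd).1 h6 hq1 with h | h
    · omega
    · exact h
  · omega

/-! ## §2 The Θ-certificate and THEOREM B₄(3555) -/

/-- **The Θ-certificate of the type `(3,5,5,5)`**: `s(n) = g(n) + Σ_{6-blocks d₀ ∈ R(n)} 𝓛(n/d₀)·g(d₀)`, `s(e) = g(e)` for `e ≠ n`;
it satisfies the certificate equations on `n` and the `2p₁pᵢ` (whose `R` has no `6`-block). [cite: TianYuanZhang2017, §3.1 (p0011 L67–L73)] -/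
theorem thetaCert_two_mul_3555 (hp₁ : p₁.Prime) (hp₂ : p₂.Prime) (hp₃ : p₃.Prime) (hp₄ : p₄.Prime) (h₁ : p₁ % 8 = 3)
    (h₂ : p₂ % 8 = 5) (h₃ : p₃ % 8 = 5) (h₄ : p₄ % 8 = 5) (D : GenusPointData (2 * (p₁ * p₂ * p₃ * p₄))) :
    ∀ e ∈ (2 * (p₁ * p₂ * p₃ * p₄)).divisors, e % 8 = 6 → (2 * (p₁ * p₂ * p₃ * p₄) / e) % 8 = 1 →
      (fun e : ℕ => if e = 2 * (p₁ * p₂ * p₃ * p₄) then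
          (gK (2 * (p₁ * p₂ * p₃ * p₄)) : ZMod 2) +
            ∑ d₀ ∈ (recursionIndex (2 * (p₁ * p₂ * p₃ * p₄))).filter (fun d₀ => d₀ % 8 = 6),
              (D.scriptL (2 * (p₁ * p₂ * p₃ * p₄) / d₀) : ZMod 2) * (gK d₀ : ZMod 2)
        else (gK e : ZMod 2)) e =
        (gK e : ZMod 2) +
          ∑ d₀ ∈ (recursionIndex e).filter (fun d₀ => d₀ % 8 = 6), (D.scriptL (e / d₀) : ZMod 2) *
            (fun e : ℕ => if e = 2 * (p₁ * p₂ * p₃ * p₄) then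
                (gK (2 * (p₁ * p₂ * p₃ * p₄)) : ZMod 2) +
                  ∑ d₀ ∈ (recursionIndex (2 * (p₁ * p₂ * p₃ * p₄))).filter (fun d₀ => d₀ % 8 = 6),
                    (D.scriptL (2 * (p₁ * p₂ * p₃ * p₄) / d₀) : ZMod 2) * (gK d₀ : ZMod 2)
              else (gK e : ZMod 2)) d₀ := by
  intro e he he6 hq1
  rcases six_block_cofactor_one_3555 hp₁ hp₂ hp₃ hp₄ h₁ h₂ h₃ h₄ (Nat.mem_divisors.mp he).1 he6 hq1 with
    rfl | ⟨rfl, -⟩ | ⟨rfl, -⟩ | ⟨rfl, -⟩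
  · -- `e = n`: inside the sum `d₀ < n`, so `s(d₀) = g(d₀)`
    simp only [if_true]
    congr 1
    refine Finset.sum_congr rfl fun d₀ hd₀ => ?_
    have hlt := lt_of_mem_recursionIndex (Finset.mem_filter.mp hd₀).1
    rw [if_neg hlt.ne]
  · -- `e = 2p₁p₂`
    have hne : 2 * (p₁ * p₂) ≠ 2 * (p₁ * p₂ * p₃ * p₄) := by
      intro h
      have h' : (p₁ * p₂) * 1 = (p₁ * p₂) * (p₃ * p₄) := by
        rw [mul_one, show (p₁ * p₂) * (p₃ * p₄) = p₁ * p₂ * p₃ * p₄ by ring]; omega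
      have h'' := Nat.eq_of_mul_eq_mul_left (Nat.mul_pos hp₁.pos hp₂.pos) h'
      have := Nat.mul_le_mul hp₃.two_le hp₄.two_le
      omega
    simp only [if_neg hne, filter_six_recursionIndex_two_mul_35 hp₁ hp₂ h₁ h₂, Finset.sum_empty, add_zero]
  · -- `e = 2p₁p₃`
    have hne : 2 * (p₁ * p₃) ≠ 2 * (p₁ * p₂ * p₃ * p₄) := by
      intro h
      have h' : (p₁ * p₃) * 1 = (p₁ * p₃) * (p₂ * p₄) := by
        rw [mul_one, show (p₁ * p₃) * (p₂ * p₄) = p₁ * p₂ * p₃ * p₄ by ring]; omega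
      have h'' := Nat.eq_of_mul_eq_mul_left (Nat.mul_pos hp₁.pos hp₃.pos) h'
      have := Nat.mul_le_mul hp₂.two_le hp₄.two_le
      omega
    simp only [if_neg hne, filter_six_recursionIndex_two_mul_35 hp₁ hp₃ h₁ h₃, Finset.sum_empty, add_zero]
  · -- `e = 2p₁p₄`
    have hne : 2 * (p₁ * p₄) ≠ 2 * (p₁ * p₂ * p₃ * p₄) := by
      intro h
      have h' : (p₁ * p₄) * 1 = (p₁ * p₄) * (p₂ * p₃) := by
        rw [mul_one, show (p₁ * p₄) * (p₂ * p₃) = p₁ * p₂ * p₃ * p₄ by ring]; omega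
      have h'' := Nat.eq_of_mul_eq_mul_left (Nat.mul_pos hp₁.pos hp₄.pos) h'
      have := Nat.mul_le_mul hp₂.two_le hp₃.two_le
      omega
    simp only [if_neg hne, filter_six_recursionIndex_two_mul_35 hp₁ hp₄ h₁ h₄, Finset.sum_empty, add_zero]

/-- **THEOREM B₄ for the type `(3,5,5,5)`, by the UNIFORM Θ-criterion.** For primes `p₁ ≡ 3`, `p₂ ≡ p₃ ≡ p₄ ≡ 5 (mod 8)` (distinct),
TYZ data `D` for `n = 2p₁p₂p₃p₄` with `D.Printed` and `D.CMPointGaloisPrinted`, TYZ Thm. 1.1 (`h11`), and rank `E_n(ℚ) ≤ 1` once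
`𝓛(n) ≠ 0` (`hr`): if `g(n)` is ODD then `𝓛(n)` is ODD. (`Θ(n) = g(n) + Σᵢ 𝓛(pⱼp_k)g(2p₁pᵢ) ≡ g(n)`: each `𝓛(pⱼp_k)` is even.)
[cite: TianYuanZhang2017, Thm. 1.1, Thm. 3.5 (p0011 L94–L112), Thm. 3.6 (2) (J741), §3.1 (p0011 L67–L73), proof of Lemma 3.21 (J759)]
[cite: LiMa2008, Thm. 0.4] -/
theorem odd_scriptL_two_mul_3555 (h11 : thm11_parity_of_scriptL) (hp₁ : p₁.Prime) (hp₂ : p₂.Prime) (hp₃ : p₃.Prime)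
    (hp₄ : p₄.Prime) (h₁ : p₁ % 8 = 3) (h₂ : p₂ % 8 = 5) (h₃ : p₃ % 8 = 5) (h₄ : p₄ % 8 = 5) (h23 : p₂ ≠ p₃) (h24 : p₂ ≠ p₄)
    (h34 : p₃ ≠ p₄) (D : GenusPointData (2 * (p₁ * p₂ * p₃ * p₄))) (hD : D.Printed) (hG : D.CMPointGaloisPrinted)
    (hr :
      letI := isElliptic_congruentNumberCurve (squarefree_two_mul_3555 hp₁ hp₂ hp₃ hp₄ h₁ h₂ h₃ h₄ h23 h24 h34).ne_zero
      D.scriptL (2 * (p₁ * p₂ * p₃ * p₄)) ≠ 0 → (congruentNumberCurve (2 * (p₁ * p₂ * p₃ * p₄))).mordellWeilRank ≤ 1)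
    (hg : Odd (gK (2 * (p₁ * p₂ * p₃ * p₄)))) : Odd (D.scriptL (2 * (p₁ * p₂ * p₃ * p₄))) := by
  have hsq := squarefree_two_mul_3555 hp₁ hp₂ hp₃ hp₄ h₁ h₂ h₃ h₄ h23 h24 h34
  have hn6 := two_mul_3555_mod_eight h₁ h₂ h₃ h₄
  have hn0 : 2 * (p₁ * p₂ * p₃ * p₄) ≠ 0 := hsq.ne_zero
  -- every `6`-block of `R(n)` contributes `𝓛(pⱼp_k)·g(2p₁pᵢ)` with `𝓛(pⱼp_k)` even
  have hsum : ∑ d₀ ∈ (recursionIndex (2 * (p₁ * p₂ * p₃ * p₄))).filter (fun d₀ => d₀ % 8 = 6),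
      (D.scriptL (2 * (p₁ * p₂ * p₃ * p₄) / d₀) : ZMod 2) * (gK d₀ : ZMod 2) = 0 := by
    refine Finset.sum_eq_zero fun d₀ hd₀ => ?_
    have hev : ∀ {q r : ℕ}, q.Prime → r.Prime → q % 8 = 5 → r % 8 = 5 → q ≠ r → q * r ∣ 2 * (p₁ * p₂ * p₃ * p₄) →
        (D.scriptL (q * r) : ZMod 2) = 0 := by
      intro q r hq hr' hq5 hr5 hqr hdvd
      have hL : IsScriptL (q * r) (D.scriptL (q * r)) :=
        hD.1 _ (Nat.mem_divisors.mpr ⟨hdvd, hn0⟩) (by have := Nat.mul_le_mul hq.two_le hr'.two_le; omega)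
      exact ZMod.intCast_eq_zero_iff_even.mpr (even_of_isScriptL_mul_55 h11 hq hr' hq5 hr5 hqr hL)
    rcases mem_filter_six_recursionIndex_3555 hp₁ hp₂ hp₃ hp₄ h₁ h₂ h₃ h₄ hd₀ with ⟨-, hq⟩ | ⟨-, hq⟩ | ⟨-, hq⟩
    · rw [hq, hev hp₃ hp₄ h₃ h₄ h34 (Dvd.intro_left (2 * (p₁ * p₂)) (by ring)), zero_mul]
    · rw [hq, hev hp₂ hp₄ h₂ h₄ h24 (Dvd.intro_left (2 * (p₁ * p₃)) (by ring)), zero_mul]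
    · rw [hq, hev hp₂ hp₃ h₂ h₃ h23 (Dvd.intro_left (2 * (p₁ * p₄)) (by ring)), zero_mul]
  refine odd_scriptL_of_thetaCert hsq hn6 D hD hG hr (thetaControlled_two_mul_3555 hp₁ hp₂ hp₃ hp₄ h₁ h₂ h₃ h₄) _
    (thetaCert_two_mul_3555 hp₁ hp₂ hp₃ hp₄ h₁ h₂ h₃ h₄ D) ?_
  simp only [if_true, hsum, add_zero]
  exact ZMod.natCast_eq_one_iff_odd.mpr hg

/-- **`𝓛(n) ≠ 0` for the type `(3,5,5,5)` with `g(n)` odd — NO rank input.** [cite: TianYuanZhang2017, Thm. 3.5 (p0011 L94–L95), Lemma 3.18] -/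
theorem scriptL_ne_zero_two_mul_3555 (h11 : thm11_parity_of_scriptL) (hp₁ : p₁.Prime) (hp₂ : p₂.Prime) (hp₃ : p₃.Prime)
    (hp₄ : p₄.Prime) (h₁ : p₁ % 8 = 3) (h₂ : p₂ % 8 = 5) (h₃ : p₃ % 8 = 5) (h₄ : p₄ % 8 = 5) (h23 : p₂ ≠ p₃) (h24 : p₂ ≠ p₄)
    (h34 : p₃ ≠ p₄) (D : GenusPointData (2 * (p₁ * p₂ * p₃ * p₄))) (hD : D.Printed) (hG : D.CMPointGaloisPrinted)
    (hg : Odd (gK (2 * (p₁ * p₂ * p₃ * p₄)))) : D.scriptL (2 * (p₁ * p₂ * p₃ * p₄)) ≠ 0 := by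
  intro h0
  have h := odd_scriptL_two_mul_3555 h11 hp₁ hp₂ hp₃ hp₄ h₁ h₂ h₃ h₄ h23 h24 h34 D hD hG (fun h => absurd h0 h) hg
  rw [h0] at h
  exact (Int.not_odd_iff_even.mpr Even.zero) h

/-- **Clause (a) at `k = 4` for the type `(3,5,5,5)` with `g(n)` odd, from the display and TYZ Thm. 1.1**: `ord_{s=1} L(E_n, s) = 1`.
No GZK, no Selmer input, no genus-sum hypothesis. CONDITIONAL; nothing asserted. [cite: TianYuanZhang2017, §1 (p0002 L46–L75), Thm. 1.1, §3] -/
theorem analyticRank_eq_one_two_mul_3555_of_cmPointGaloisData (hCM : tyz_cmPointGaloisData) (h11 : thm11_parity_of_scriptL)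
    (hp₁ : p₁.Prime) (hp₂ : p₂.Prime) (hp₃ : p₃.Prime) (hp₄ : p₄.Prime) (h₁ : p₁ % 8 = 3) (h₂ : p₂ % 8 = 5)
    (h₃ : p₃ % 8 = 5) (h₄ : p₄ % 8 = 5) (h23 : p₂ ≠ p₃) (h24 : p₂ ≠ p₄) (h34 : p₃ ≠ p₄)
    (hg : Odd (gK (2 * (p₁ * p₂ * p₃ * p₄)))) : (congruentNumberCurve (2 * (p₁ * p₂ * p₃ * p₄))).analyticRank = 1 := by
  have hsq := squarefree_two_mul_3555 hp₁ hp₂ hp₃ hp₄ h₁ h₂ h₃ h₄ h23 h24 h34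
  have hn6 := two_mul_3555_mod_eight h₁ h₂ h₃ h₄
  obtain ⟨D, hD, hG⟩ := hCM _ hsq (Or.inr (Or.inl hn6))
  have hL : IsScriptL _ (D.scriptL (2 * (p₁ * p₂ * p₃ * p₄))) := hD.1 _ (Nat.mem_divisors_self _ hsq.ne_zero) (by omega)
  exact analyticRank_congruentNumberCurve_eq_one_of_isScriptL hsq (Or.inr (Or.inl hn6)) hL
    (scriptL_ne_zero_two_mul_3555 h11 hp₁ hp₂ hp₃ hp₄ h₁ h₂ h₃ h₄ h23 h24 h34 D hD hG hg)

/-- **THEOREM B₄(3555), output shape**: an ODD integer `L` with `L² = 𝓛(n)²`, relative to {`tyz_cmPointGaloisData`, TYZ Thm. 1.1, GZK}.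
CONDITIONAL; nothing asserted. [cite: TianYuanZhang2017, Thm. 3.5 and §3] -/
theorem exists_odd_isScriptL_two_mul_3555 (hCM : tyz_cmPointGaloisData) (h11 : thm11_parity_of_scriptL)
    (hGZK : rank_eq_analyticRank_of_analyticRank_le_one) (hp₁ : p₁.Prime) (hp₂ : p₂.Prime) (hp₃ : p₃.Prime)
    (hp₄ : p₄.Prime) (h₁ : p₁ % 8 = 3) (h₂ : p₂ % 8 = 5) (h₃ : p₃ % 8 = 5) (h₄ : p₄ % 8 = 5) (h23 : p₂ ≠ p₃) (h24 : p₂ ≠ p₄)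
    (h34 : p₃ ≠ p₄) (hg : Odd (gK (2 * (p₁ * p₂ * p₃ * p₄)))) :
    ∃ L : ℤ, Odd L ∧ IsScriptL (2 * (p₁ * p₂ * p₃ * p₄)) L := by
  have hsq := squarefree_two_mul_3555 hp₁ hp₂ hp₃ hp₄ h₁ h₂ h₃ h₄ h23 h24 h34
  haveI := isElliptic_congruentNumberCurve hsq.ne_zero
  have hn6 := two_mul_3555_mod_eight h₁ h₂ h₃ h₄
  obtain ⟨D, hD, hG⟩ := hCM _ hsq (Or.inr (Or.inl hn6))
  have hL : IsScriptL _ (D.scriptL (2 * (p₁ * p₂ * p₃ * p₄))) := hD.1 _ (Nat.mem_divisors_self _ hsq.ne_zero) (by omega)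
  refine ⟨_, odd_scriptL_two_mul_3555 h11 hp₁ hp₂ hp₃ hp₄ h₁ h₂ h₃ h₄ h23 h24 h34 D hD hG (fun hL0 => ?_) hg, hL⟩
  have har := S4 hsq (Or.inr (Or.inl hn6)) hL hL0
  rw [(hGZK (congruentNumberCurve _) har).1]; exact har

/-! ## §3 The family theorem on the Legendre symbols -/

/-- **Clause (a) at `k = 4` on the explicit family, from {`tyz_cmPointGaloisData`, TYZ Thm. 1.1}**: for distinct primes `p₁ ≡ 3`,
`p₂ ≡ p₃ ≡ p₄ ≡ 5 (mod 8)` such that the number of PAIRS of `−1`-symbols among `(p₂/p₁), (p₃/p₁), (p₄/p₁), (p₃/p₂), (p₄/p₂), (p₄/p₃)`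
sharing a prime is EVEN (the twelve-term bit identity below, i.e. `g(2p₁p₂p₃p₄)` odd — Rédei–Reichardt, a tree theorem):
`ord_{s=1} L(E_{2p₁p₂p₃p₄}, s) = 1`. Smallest silent member of the census: `11310 = 2·3·5·13·29`. CONDITIONAL; nothing asserted.
[cite: TianYuanZhang2017, §1 (definition of 𝓛(n), p0002 L46–L75), Thm. 1.1, §3] [cite: LiMa2008, Thm. 0.4] -/
theorem analyticRank_eq_one_two_mul_3555_family (hCM : tyz_cmPointGaloisData) (h11 : thm11_parity_of_scriptL) :
    ∀ p₁ p₂ p₃ p₄ : ℕ, p₁.Prime → p₂.Prime → p₃.Prime → p₄.Prime → p₁ % 8 = 3 → p₂ % 8 = 5 → p₃ % 8 = 5 → p₄ % 8 = 5 →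
      p₂ ≠ p₃ → p₂ ≠ p₄ → p₃ ≠ p₄ →
      kroneckerBit p₂ p₁ * kroneckerBit p₃ p₁ + kroneckerBit p₂ p₁ * kroneckerBit p₄ p₁ +
        kroneckerBit p₂ p₁ * kroneckerBit p₃ p₂ + kroneckerBit p₂ p₁ * kroneckerBit p₄ p₂ +
        kroneckerBit p₃ p₁ * kroneckerBit p₄ p₁ + kroneckerBit p₃ p₁ * kroneckerBit p₃ p₂ + kroneckerBit p₃ p₁ * kroneckerBit p₄ p₃ +
        kroneckerBit p₄ p₁ * kroneckerBit p₄ p₂ + kroneckerBit p₄ p₁ * kroneckerBit p₄ p₃ +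
        kroneckerBit p₃ p₂ * kroneckerBit p₄ p₂ + kroneckerBit p₃ p₂ * kroneckerBit p₄ p₃ +
        kroneckerBit p₄ p₂ * kroneckerBit p₄ p₃ = 0 →
      (congruentNumberCurve (2 * (p₁ * p₂ * p₃ * p₄))).analyticRank = 1 := by
  intro p₁ p₂ p₃ p₄ hp₁ hp₂ hp₃ hp₄ h₁ h₂ h₃ h₄ h23 h24 h34 hbits
  refine analyticRank_eq_one_two_mul_3555_of_cmPointGaloisData hCM h11 hp₁ hp₂ hp₃ hp₄ h₁ h₂ h₃ h₄ h23 h24 h34 ?_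
  rw [← ZMod.natCast_eq_one_iff_odd, natCast_gK_two_mul_3555 hp₁ hp₂ hp₃ hp₄ h₁ h₂ h₃ h₄ h23 h24 h34, hbits, add_zero]

end ThetaDescent

end Summit.BirchSwinnertonDyer.Rank1Residual.P2

end
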